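import Mathlib.Analysis.Fourier.Inversion
import Mathlib.Analysis.SpecialFunctions.JapaneseBracket
import Mathlib.Analysis.Distribution.SchwartzSpace.Fourier
import Mathlib.Analysis.InnerProductSpace.PiL2
import HarnessLib

/-!
# Fibre densities of a non-degenerate real quadratic form (archimedean `|θ_i|` of Weil 1965), I: the Fourier road

Topic `NumberTheory/Weil1965`; namespace `Literature.NumberTheory.Weil1965`. KERNEL mathematics only (three
definitions with bodies + theorems; no named fact, no `axiom`, no `sorry`; Mathlib-only imports).

Let `V = ℝ^ι` (`EuclideanSpace ℝ ι`, Lebesgue measure, `n = |ι|`) and `q_d(v) = ∑ᵢ dᵢ vᵢ²` a DIAGONAL real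
quadratic form (every non-degenerate real form is of this shape in orthonormal coordinates,
[Weil1964, Chap. II n° 26]). For `Φ : V → ℂ` put ([Weil1965, Chap. I n° 1 formula (1); Chap. III n° 37
Prop. 6]):
* `F*_Φ(t) = quadGaussTransform d Φ t := ∫ Φ(v) e^{2πi t q_d(v)} dv` — Weil's `F*_Φ(i*) = ∫ Φ(x) χ(i* i_X(x)) dx`,
  the Fourier transform (at the character `t`) of the push-forward of the measure `Φ dv` under `q_d`;
* `F_Φ = quadFibreDensity d Φ := 𝓕 (F*_Φ)`, `F_Φ(b) = ∫ e^{-2πi t b} F*_Φ(t) dt` — Weil's `F_Φ(i) = ∫ Φ |θ_i|`.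

This file is the SOFT half of [Weil1965, Chap. III n° 37, PROPOSITION 6, p. 54] («pour tout `Φ ∈ 𝒮(X)`, les
fonctions `F_Φ`, `F*_Φ` ... sont continues, intégrables, et sont les transformées de Fourier l'une de l'autre»)
at a real place, i.e. [Weil1965, Chap. I n° 1–2, Lemmes 1–3 / Prop. 1]: everything that follows from
`F*_Φ ∈ L¹(ℝ)` (Weil's condition (A)); the sequel `RealQuadraticFormFibreDensityDecay.lean` proves
`‖F*_Φ(t)‖ ≪ |t|^{-n/2}` ([Weil1964, Chap. I n° 14 Thm 2]) and hence (A) for `n ≥ 3`.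
* §1 `q_d`; `‖F*_Φ(t)‖ ≤ ‖Φ‖₁`; `F*_Φ` continuous (`norm_quadGaussTransform_le`, `continuous_quadGaussTransform`).
* §2 `F_Φ` continuous, `‖F_Φ(b)‖ ≤ ‖F*_Φ‖₁` (`continuous_quadFibreDensity`, `norm_quadFibreDensity_le`);
  integrability of `F*_Φ` from a power decay `‖F*_Φ(t)‖ ≤ C|t|^{-s}`, `s > 1`
  (`integrable_quadGaussTransform_of_norm_le_rpow`).
* §3 THE PUSH-FORWARD IDENTITY (`integral_mul_comp_quadFormDiag_eq`): for `Φ ∈ L¹(V)` with `F*_Φ ∈ L¹(ℝ)` and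
  every continuous `g ∈ L¹(ℝ)` with `𝓕 g ∈ L¹(ℝ)`,
  `∫ Φ(v) g(q_d(v)) dv = ∫ F_Φ(b) g(b) db`,
  i.e. `(q_d)_*(Φ dv) = F_Φ(b) db` against such weights, the singular fibre `b = 0` INCLUDED (Fourier
  inversion for `g`, Fubini, self-adjointness of `𝓕`); Schwartz weights: `integral_mul_comp_quadFormDiag_schwartz`.

Sequels: `…FibreDensityDecay.lean` (condition (A) via Weil's index), `…FibreDensityLaws.lean` (uniqueness of
`F_Φ`, reality/positivity, dilation/scaling laws, `b^k F_Φ = F_{q^k Φ}`, decay in `b`). Not treated: finite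
places (`SplitPlaceFibreMeasures`); the packaging per archimedean place of a number field.

## References
* [Weil1965] A. Weil, *Sur la formule de Siegel dans la théorie des groupes classiques*, Acta Math. 113
  (1965) 1–87: Chap. I n° 1–2 (formula (1), Lemmes 1–3, Prop. 1) pp. 3–7; Chap. III n° 37, Prop. 6, p. 54.
* [Weil1964] A. Weil, *Sur certains groupes d'opérateurs unitaires*, Acta Math. 111 (1964): Chap. I n° 14
  Théorème 2, p. 161; Chap. II n° 26, p. 173.
-/

set_option autoImplicit false

noncomputable section

open MeasureTheory Complex Filter Topology Set Finset
open scoped Real FourierTransform SchwartzMap BigOperators ComplexConjugate RealInnerProductSpace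

namespace Literature.NumberTheory.Weil1965

variable {ι : Type*} [Fintype ι]

/-! ## §1 The diagonal form `q_d` and Weil's `F*_Φ` -/

/-- the diagonal real quadratic form `q_d(v) = ∑ᵢ dᵢ vᵢ²` on `ℝ^ι`.
[cite: Weil1964, Chap. II n° 26, p. 173] -/
def quadFormDiag (d : ι → ℝ) (v : EuclideanSpace ℝ ι) : ℝ := ∑ i, d i * v i ^ 2

/-- unfolding. [cite: Weil1964, Chap. II n° 26, p. 173] -/
theorem quadFormDiag_apply (d : ι → ℝ) (v : EuclideanSpace ℝ ι) :
    quadFormDiag d v = ∑ i, d i * v i ^ 2 := rfl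

/-- `q_d` is continuous. [cite: Weil1964, Chap. II n° 26, p. 173] -/
theorem continuous_quadFormDiag (d : ι → ℝ) : Continuous (quadFormDiag d) := by
  unfold quadFormDiag
  exact continuous_finsetSum _ fun i _ => continuous_const.mul ((PiLp.continuous_apply 2 _ i).pow 2)

/-- `q_{t d} = t q_d`. [cite: Weil1964, Chap. II n° 26, p. 173] -/
theorem quadFormDiag_smul (t : ℝ) (d : ι → ℝ) (v : EuclideanSpace ℝ ι) :
    quadFormDiag (t • d) v = t * quadFormDiag d v := by
  simp only [quadFormDiag, Pi.smul_apply, smul_eq_mul, Finset.mul_sum, mul_assoc]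

/-- homogeneity `q_d(s v) = s² q_d(v)` (a quadratic form is homogeneous of degree 2).
[cite: Weil1964, Chap. II n° 26, p. 173] -/
theorem quadFormDiag_smul_left (d : ι → ℝ) (s : ℝ) (v : EuclideanSpace ℝ ι) :
    quadFormDiag d (s • v) = s ^ 2 * quadFormDiag d v := by
  simp only [quadFormDiag, PiLp.smul_apply, smul_eq_mul, Finset.mul_sum]
  exact Finset.sum_congr rfl fun i _ => by ring

/-- the second-degree character `e(t q_d(v)) = e^{2πi t q_d(v)}` as a function of `(t, v)`.
[cite: Weil1965, Chap. I n° 1 (1), p. 3] -/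
def quadChar (d : ι → ℝ) (t : ℝ) (v : EuclideanSpace ℝ ι) : ℂ :=
  cexp (2 * π * I * ((t * quadFormDiag d v : ℝ) : ℂ))

/-- unfolding. [cite: Weil1965, Chap. I n° 1 (1), p. 3] -/
theorem quadChar_apply (d : ι → ℝ) (t : ℝ) (v : EuclideanSpace ℝ ι) :
    quadChar d t v = cexp (2 * π * I * ((t * quadFormDiag d v : ℝ) : ℂ)) := rfl

/-- `e(t q_d(v))` is Mathlib's additive character `𝐞` at `t q_d(v)`. [cite: Weil1965, Chap. I n° 1 (1), p. 3] -/
theorem quadChar_eq_fourierChar (d : ι → ℝ) (t : ℝ) (v : EuclideanSpace ℝ ι) :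
    quadChar d t v = 𝐞 (t * quadFormDiag d v) := by
  rw [quadChar_apply, Real.fourierChar_apply]
  congr 1
  push_cast
  ring

/-- `|e(t q_d(v))| = 1` (a character is unimodular). [cite: Weil1965, Chap. I n° 1 (1), p. 3] -/
theorem norm_quadChar (d : ι → ℝ) (t : ℝ) (v : EuclideanSpace ℝ ι) : ‖quadChar d t v‖ = 1 := by
  rw [quadChar_apply, Complex.norm_exp]
  simp

/-- joint continuity of `(t, v) ↦ e(t q_d(v))`. [cite: Weil1965, Chap. I n° 1 (1), p. 3] -/
theorem continuous_quadChar_uncurry (d : ι → ℝ) :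
    Continuous fun p : ℝ × EuclideanSpace ℝ ι => quadChar d p.1 p.2 := by
  unfold quadChar
  exact Complex.continuous_exp.comp (continuous_const.mul (Complex.continuous_ofReal.comp
    (continuous_fst.mul ((continuous_quadFormDiag d).comp continuous_snd))))

/-- Weil's `F*_Φ(t) = ∫ Φ(v) e^{2πi t q_d(v)} dv`: the Fourier transform, at the character `t`, of the
push-forward of `Φ dv` under `q_d`. [cite: Weil1965, Chap. I n° 1 (1), p. 3; Chap. III n° 37 Prop. 6, p. 54] -/
def quadGaussTransform (d : ι → ℝ) (Φ : EuclideanSpace ℝ ι → ℂ) (t : ℝ) : ℂ :=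
  ∫ v, Φ v * quadChar d t v

/-- unfolding. [cite: Weil1965, Chap. I n° 1 (1), p. 3] -/
theorem quadGaussTransform_apply (d : ι → ℝ) (Φ : EuclideanSpace ℝ ι → ℂ) (t : ℝ) :
    quadGaussTransform d Φ t = ∫ v, Φ v * quadChar d t v := rfl

/-- the integrand of `F*_Φ` has norm `‖Φ‖`. [cite: Weil1965, Chap. I n° 1 (1), p. 3] -/
theorem norm_mul_quadChar (d : ι → ℝ) (Φ : EuclideanSpace ℝ ι → ℂ) (t : ℝ) (v : EuclideanSpace ℝ ι) :
    ‖Φ v * quadChar d t v‖ = ‖Φ v‖ := by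
  rw [norm_mul, norm_quadChar, mul_one]

/-- `‖F*_Φ(t)‖ ≤ ‖Φ‖₁` («continue et bornée»). [cite: Weil1965, Chap. I n° 1, p. 3] -/
theorem norm_quadGaussTransform_le (d : ι → ℝ) (Φ : EuclideanSpace ℝ ι → ℂ) (t : ℝ) :
    ‖quadGaussTransform d Φ t‖ ≤ ∫ v, ‖Φ v‖ := by
  rw [quadGaussTransform_apply]
  refine (norm_integral_le_integral_norm _).trans (le_of_eq ?_)
  simp_rw [norm_mul_quadChar]

/-- the integrand of `F*_Φ(t)` is a.e.-strongly measurable. [folklore] -/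
private theorem aestronglyMeasurable_mul_quadChar (d : ι → ℝ) {Φ : EuclideanSpace ℝ ι → ℂ}
    (hΦ : AEStronglyMeasurable Φ volume) (t : ℝ) :
    AEStronglyMeasurable (fun v => Φ v * quadChar d t v) volume :=
  hΦ.mul ((continuous_quadChar_uncurry d).comp (Continuous.prodMk_right t)).aestronglyMeasurable

/-- the integrand of `F*_Φ(t)` is integrable for integrable `Φ` («`Φ ∈ L¹(X)`»).
[cite: Weil1965, Chap. I n° 1 (1), p. 3] -/
theorem integrable_mul_quadChar (d : ι → ℝ) {Φ : EuclideanSpace ℝ ι → ℂ} (hΦ : Integrable Φ) (t : ℝ) :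
    Integrable (fun v => Φ v * quadChar d t v) :=
  hΦ.norm.mono' (aestronglyMeasurable_mul_quadChar d hΦ.1 t)
    (ae_of_all _ fun v => (norm_mul_quadChar d Φ t v).le)

/-- `F*_Φ` is continuous for integrable `Φ` («continue et bornée»). [cite: Weil1965, Chap. I n° 1, p. 3] -/
theorem continuous_quadGaussTransform (d : ι → ℝ) {Φ : EuclideanSpace ℝ ι → ℂ} (hΦ : Integrable Φ) :
    Continuous (quadGaussTransform d Φ) := by
  refine continuous_of_dominated (bound := fun v => ‖Φ v‖)
    (fun t => aestronglyMeasurable_mul_quadChar d hΦ.1 t)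
    (fun t => ae_of_all _ fun v => (norm_mul_quadChar d Φ t v).le) hΦ.norm
    (ae_of_all _ fun v => ?_)
  exact continuous_const.mul ((continuous_quadChar_uncurry d).comp (continuous_id.prodMk continuous_const))

/-! ## §2 Weil's `F_Φ = 𝓕 F*_Φ`; integrability of `F*_Φ` from a power decay -/

/-- Weil's `F_Φ = 𝓕 F*_Φ`, `F_Φ(b) = ∫ e^{-2πi t b} F*_Φ(t) dt`: the FIBRE DENSITY of `Φ dv` along `q_d = b`
(Weil's `∫ Φ |θ_b|`). [cite: Weil1965, Chap. III n° 37 Prop. 6, p. 54] -/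
def quadFibreDensity (d : ι → ℝ) (Φ : EuclideanSpace ℝ ι → ℂ) : ℝ → ℂ :=
  𝓕 (quadGaussTransform d Φ)

/-- unfolding. [cite: Weil1965, Chap. III n° 37 Prop. 6, p. 54] -/
theorem quadFibreDensity_eq (d : ι → ℝ) (Φ : EuclideanSpace ℝ ι → ℂ) :
    quadFibreDensity d Φ = 𝓕 (quadGaussTransform d Φ) := rfl

/-- `F_Φ(b) = ∫ e^{-2πi t b} F*_Φ(t) dt`. [cite: Weil1965, Chap. III n° 37 Prop. 6, p. 54] -/
theorem quadFibreDensity_apply (d : ι → ℝ) (Φ : EuclideanSpace ℝ ι → ℂ) (b : ℝ) :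
    quadFibreDensity d Φ b = ∫ t, 𝐞 (-(t * b)) • quadGaussTransform d Φ t := by
  rw [quadFibreDensity_eq, Real.fourier_real_eq]

/-- `F_Φ` is continuous when `F*_Φ ∈ L¹`. [cite: Weil1965, Chap. III n° 37 Prop. 6, p. 54] -/
theorem continuous_quadFibreDensity (d : ι → ℝ) {Φ : EuclideanSpace ℝ ι → ℂ}
    (hG : Integrable (quadGaussTransform d Φ)) : Continuous (quadFibreDensity d Φ) := by
  rw [quadFibreDensity_eq]
  exact VectorFourier.fourierIntegral_continuous Real.continuous_fourierChar
    (by exact continuous_inner) hG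

/-- `‖F_Φ(b)‖ ≤ ‖F*_Φ‖₁`. [cite: Weil1965, Chap. III n° 37 Prop. 6, p. 54] -/
theorem norm_quadFibreDensity_le (d : ι → ℝ) (Φ : EuclideanSpace ℝ ι → ℂ) (b : ℝ) :
    ‖quadFibreDensity d Φ b‖ ≤ ∫ t, ‖quadGaussTransform d Φ t‖ := by
  rw [quadFibreDensity_apply]
  refine (norm_integral_le_integral_norm _).trans (le_of_eq ?_)
  congr 1 with t
  rw [Circle.norm_smul]

/-- the two-sided bound `min(A, C|t|^{-s}) ≤ max(A, C) 2^s (1 + |t|)^{-s}`. [folklore] -/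
private theorem min_le_japaneseBracket {A C s t : ℝ} (hA : 0 ≤ A) (hC : 0 ≤ C) (hs : 0 ≤ s) (ht : t ≠ 0) :
    min A (C * |t| ^ (-s)) ≤ max A C * 2 ^ s * (1 + |t|) ^ (-s) := by
  have h1 : 0 < 1 + |t| := by positivity
  rcases le_or_gt |t| 1 with hle | hgt
  · -- `|t| ≤ 1`: `A ≤ A · 2^s (1+|t|)^{-s}` since `(1+|t|)^s ≤ 2^s`
    calc min A (C * |t| ^ (-s)) ≤ A := min_le_left _ _
      _ = A * 2 ^ s * 2⁻¹ ^ s := by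
          rw [mul_assoc, ← Real.mul_rpow (by norm_num) (by norm_num)]; norm_num
      _ ≤ max A C * 2 ^ s * (1 + |t|) ^ (-s) := by
          rw [Real.rpow_neg h1.le, ← Real.inv_rpow h1.le]
          gcongr
          · exact le_max_left _ _
          · linarith
  · -- `|t| > 1`: `|t|^{-s} ≤ 2^s (1+|t|)^{-s}` since `1 + |t| ≤ 2|t|`
    have ht' : 0 < |t| := by positivity
    calc min A (C * |t| ^ (-s)) ≤ C * |t| ^ (-s) := min_le_right _ _
      _ ≤ C * (2 ^ s * (1 + |t|) ^ (-s)) := by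
          gcongr
          rw [Real.rpow_neg ht'.le, Real.rpow_neg h1.le, ← Real.inv_rpow ht'.le, ← Real.inv_rpow h1.le,
            ← Real.mul_rpow (by norm_num) (by positivity)]
          exact Real.rpow_le_rpow (by positivity)
            (by rw [inv_eq_one_div, inv_eq_one_div, mul_one_div, div_le_div_iff₀ ht' h1]; linarith) hs
      _ ≤ max A C * 2 ^ s * (1 + |t|) ^ (-s) := by
          rw [← mul_assoc]; gcongr; exact le_max_right _ _

/-- integrability of `F*_Φ` from a POWER DECAY `‖F*_Φ(t)‖ ≤ C |t|^{-s}` (`t ≠ 0`) with `s > 1`, for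
integrable `Φ` (so that `F*_Φ` is continuous and bounded by `‖Φ‖₁` near `0`) — the form in which Weil's
condition (A) «`F*_Φ ∈ L¹`» is checked at a real place. [cite: Weil1965, Chap. III n° 34, p. 49] -/
theorem integrable_quadGaussTransform_of_norm_le_rpow (d : ι → ℝ) {Φ : EuclideanSpace ℝ ι → ℂ}
    (hΦ : Integrable Φ) {C s : ℝ} (hs : 1 < s)
    (hdecay : ∀ t : ℝ, t ≠ 0 → ‖quadGaussTransform d Φ t‖ ≤ C * |t| ^ (-s)) :
    Integrable (quadGaussTransform d Φ) := by
  set A : ℝ := ∫ v, ‖Φ v‖ with hA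
  have hA0 : 0 ≤ A := integral_nonneg fun _ => norm_nonneg _
  have hC0 : 0 ≤ C := by
    have h1 := hdecay 1 one_ne_zero
    have : (0 : ℝ) ≤ C * |(1:ℝ)| ^ (-s) := (norm_nonneg _).trans h1
    simpa using this
  -- domination by the Japanese bracket `(1 + |t|)^{-s}`, integrable on `ℝ` since `s > 1 = dim ℝ`
  have hJ : Integrable fun t : ℝ => max A C * 2 ^ s * (1 + ‖t‖) ^ (-s) :=
    (integrable_one_add_norm (by simpa using hs)).const_mul _
  refine hJ.mono' (continuous_quadGaussTransform d hΦ).aestronglyMeasurable (ae_of_all _ fun t => ?_)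
  rw [Real.norm_eq_abs]
  rcases eq_or_ne t 0 with rfl | ht
  · calc ‖quadGaussTransform d Φ 0‖ ≤ A := norm_quadGaussTransform_le d Φ 0
      _ ≤ max A C * 2 ^ s * (1 + |(0:ℝ)|) ^ (-s) := by
          simp only [abs_zero, add_zero, Real.one_rpow, mul_one]
          exact (le_max_left A C).trans (le_mul_of_one_le_right (le_max_of_le_left hA0)
            (Real.one_le_rpow (by norm_num) (by linarith)))
  · exact (le_min (norm_quadGaussTransform_le d Φ t) (hdecay t ht)).trans
      (min_le_japaneseBracket hA0 hC0 (by linarith) ht)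

/-! ## §3 The push-forward identity `∫ Φ (g ∘ q_d) = ∫ F_Φ g` -/

/-- Fourier inversion on `ℝ`, pointwise: `g(b) = ∫ e^{2πi t b} 𝓕g(t) dt` for continuous `g ∈ L¹` with
`𝓕 g ∈ L¹`. [folklore] -/
private theorem eq_integral_fourierChar_smul_fourier {g : ℝ → ℂ} (hgc : Continuous g) (hgi : Integrable g)
    (hgF : Integrable (𝓕 g)) (b : ℝ) : g b = ∫ t, 𝐞 (t * b) • 𝓕 g t := by
  have h := congrFun (hgc.fourierInv_fourier_eq hgi hgF) b
  rw [← h, Real.fourierInv_eq]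
  congr 1 with t
  simp [mul_comm]

/-- the Fubini integrand `(v, t) ↦ Φ(v) e(t q_d(v)) 𝓕g(t)` is integrable on `V × ℝ`. [folklore] -/
private theorem integrable_fubini_integrand (d : ι → ℝ) {Φ : EuclideanSpace ℝ ι → ℂ} (hΦ : Integrable Φ)
    {h : ℝ → ℂ} (hh : Integrable h) :
    Integrable (Function.uncurry fun (v : EuclideanSpace ℝ ι) (t : ℝ) => Φ v * (quadChar d t v * h t))
      (volume.prod volume) := by
  have hmeas : AEStronglyMeasurable
      (Function.uncurry fun (v : EuclideanSpace ℝ ι) (t : ℝ) => Φ v * (quadChar d t v * h t))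
      (volume.prod volume) := by
    refine (hΦ.1.comp_fst).mul (AEStronglyMeasurable.mul ?_ hh.1.comp_snd)
    exact ((continuous_quadChar_uncurry d).comp continuous_swap).aestronglyMeasurable
  refine (hΦ.mul_prod hh).mono hmeas (ae_of_all _ fun p => ?_)
  rcases p with ⟨v, t⟩
  simp only [Function.uncurry_apply_pair, norm_mul, norm_quadChar, one_mul]
  exact le_rfl

/-- **The push-forward of `Φ dv` under `q_d` has density `F_Φ`** (Weil's `|θ_i|` at a real place, read
against admissible weights): for `Φ ∈ L¹(ℝ^ι)` with `F*_Φ ∈ L¹(ℝ)` and every continuous `g ∈ L¹(ℝ)` with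
`𝓕 g ∈ L¹(ℝ)`, `∫ Φ(v) g(q_d(v)) dv = ∫ F_Φ(b) g(b) db` — the singular fibre `b = 0` included.
[cite: Weil1965, Chap. I n° 1–2 Lemme 1–3 and Prop. 1, pp. 3–7; Chap. III n° 37 Prop. 6, p. 54] -/
theorem integral_mul_comp_quadFormDiag_eq (d : ι → ℝ) {Φ : EuclideanSpace ℝ ι → ℂ} (hΦ : Integrable Φ)
    (hG : Integrable (quadGaussTransform d Φ)) {g : ℝ → ℂ} (hgc : Continuous g) (hgi : Integrable g)
    (hgF : Integrable (𝓕 g)) :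
    ∫ v, Φ v * g (quadFormDiag d v) = ∫ b, quadFibreDensity d Φ b * g b := by
  -- (1) both sides equal `∫ F*_Φ(t) 𝓕g(t) dt`; left side: Fourier inversion for `g` + Fubini
  have hL : ∫ v, Φ v * g (quadFormDiag d v) = ∫ t, quadGaussTransform d Φ t * 𝓕 g t := by
    have h1 : ∀ v, Φ v * g (quadFormDiag d v) = ∫ t, Φ v * (quadChar d t v * 𝓕 g t) := fun v => by
      rw [integral_const_mul, eq_integral_fourierChar_smul_fourier hgc hgi hgF (quadFormDiag d v)]
      congr 1
      congr 1 with t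
      rw [quadChar_eq_fourierChar, Circle.smul_def, smul_eq_mul]
    simp_rw [h1]
    rw [integral_integral_swap (integrable_fubini_integrand d hΦ hgF)]
    congr 1 with t
    rw [quadGaussTransform_apply, ← integral_mul_const]
    congr 1 with v
    ring
  -- (2) right side: self-adjointness of `𝓕`
  have hR : ∫ b, quadFibreDensity d Φ b * g b = ∫ t, quadGaussTransform d Φ t * 𝓕 g t := by
    have h := VectorFourier.integral_fourierIntegral_smul_eq_flip (L := innerₗ ℝ) (μ := volume)
      (ν := volume) Real.continuous_fourierChar (by exact continuous_inner) hG hgi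
    simp only [flip_innerₗ, smul_eq_mul] at h
    exact h
  rw [hL, hR]

/-- the push-forward identity for SCHWARTZ weights `g ∈ 𝒮(ℝ)`.
[cite: Weil1965, Chap. III n° 37 Prop. 6, p. 54] -/
theorem integral_mul_comp_quadFormDiag_schwartz (d : ι → ℝ) {Φ : EuclideanSpace ℝ ι → ℂ} (hΦ : Integrable Φ)
    (hG : Integrable (quadGaussTransform d Φ)) (g : 𝓢(ℝ, ℂ)) :
    ∫ v, Φ v * g (quadFormDiag d v) = ∫ b, quadFibreDensity d Φ b * g b :=
  integral_mul_comp_quadFormDiag_eq d hΦ hG g.continuous g.integrable (by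
    rw [← SchwartzMap.fourier_coe]; exact (𝓕 g).integrable)

/-- the push-forward identity for SMOOTH COMPACTLY SUPPORTED REAL weights `g ∈ C_c^∞(ℝ)` (the test class of
Mathlib's `ae_eq_zero_of_integral_contDiff_smul_eq_zero`). [cite: Weil1965, Chap. III n° 37 Prop. 6, p. 54] -/
theorem integral_mul_comp_quadFormDiag_smooth (d : ι → ℝ) {Φ : EuclideanSpace ℝ ι → ℂ} (hΦ : Integrable Φ)
    (hG : Integrable (quadGaussTransform d Φ)) {g : ℝ → ℝ} (hg : ContDiff ℝ (⊤ : ℕ∞) g)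
    (hgs : HasCompactSupport g) :
    ∫ v, Φ v * (g (quadFormDiag d v) : ℂ) = ∫ b, quadFibreDensity d Φ b * (g b : ℂ) := by
  have hc : ContDiff ℝ (⊤ : ℕ∞) fun x => (g x : ℂ) := Complex.ofRealCLM.contDiff.comp hg
  have hs : HasCompactSupport fun x => (g x : ℂ) := hgs.comp_left Complex.ofReal_zero
  exact integral_mul_comp_quadFormDiag_schwartz d hΦ hG (hs.toSchwartzMap hc)

end Literature.NumberTheory.Weil1965
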